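import Summits.ResolutionOfSingularities.ResolutionOfSingularities.Theorems.SharpStrataSepExcModelsModelValuationOrder
import Summits.ResolutionOfSingularities.ResolutionOfSingularities.Theorems.SharpStrataSepExcModelsModelValuationResidue
import Summits.ResolutionOfSingularities.ResolutionOfSingularities.Theorems.SharpStrataSepExcModelsModelValuationAbhyankar
import Literature.AlgebraicGeometry.Resolution.PrimeDivisors
import HarnessLib

/-!
# A separable regular birational local model yields a separable Abhyankar place

Line `birth` of crux `SharpStrata.SepExcModels` (stmt-ResolutionOfSingularities-16828,
`Cruxes/SepExcModels/Lines/birth.lean`), lead c1, tool stub (T6, ring form)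
`stub_sepAbhyankarPlace_of_model`, PROVED: the CONVERSE of the valuative criterion.

Setting: `A` a finitely generated algebra over a field `k` with fraction field `K`, `R = A_P`
inside `K`, `B = R[s] ⊆ K` (`s` finite), a prime `𝔮` of `B` over `𝔪_R` with `B_𝔮` regular and
`(B/𝔮)[1/g]` smooth over `κ(R)` for some `g ∉ 𝔮` (the third disjunct of `SepExcAt`).
Conclusion: a valuation ring `O` of `K` with a map `φ : R → O` over `K`, dominating `R`, which
is an ABHYANKAR place of `K | k` and whose residue field is FORMALLY SMOOTH over `κ(R)`.

## Proof

* If `𝔮 = 0` then `𝔪_R = 0`, `R = K`, and the trivial place `O = K` does it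
  (`ModelValuationAbhyankar.isAbhyankarPlace_top`, `formallySmooth_quotient_of_bijective`).
* Otherwise `S = B_𝔮` is a regular local ring of dimension `e ≥ 1` with `Frac S = K`, and we take
  the ORDER VALUATION `O = S[𝔪/x_1]_{(x_1)}` of `S`
  (`ModelValuationOrder.exists_orderValuation`): it dominates `S`, hence `R`; its residue field
  is formally smooth of transcendence degree `e - 1` over `κ(S)`, and `κ(S) = Frac((B/𝔮)[1/g])`
  is formally smooth over `κ(R)` (`ModelValuationResidue.formallySmooth_residueField_of_model`),
  so `κ(O)` is formally smooth over `κ(R)`; finally `tr.deg_k κ(S) + e = tr.deg_k K`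
  (`ModelValuationResidue.exists_trdeg_residueField_add_eq`, the dimension formula for the
  affine domain `A[s]`), so `tr.deg_k κ(O) = tr.deg_k K - 1`: `O` is a prime divisor, hence an
  Abhyankar place (`ModelValuationAbhyankar.isAbhyankarPlace_of_valuation_lt_one`, Knaf–Kuhlmann
  2005 Thm. 2.1, with one element of `𝔪_S` and lifts of a transcendence basis of `κ(O)`).

## Sources

* O. Zariski, P. Samuel, *Commutative Algebra* II (1960), Ch. VI §14, Thm. 31 (prime divisors).
  [ZariskiSamuel1960]
* H. Knaf, F.-V. Kuhlmann, Ann. Sci. ÉNS 38 (2005) 833–846, Thm. 2.1. [KnafKuhlmann2005]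
* A. Benito, O. Piltant, A. J. Reguera, J. Pure Appl. Algebra 226 (2022) 107113, Q6.6 and
  Lemma 4.2 (separably exceptional points). [BenitoPiltantReguera2022]
-/

noncomputable section

-- single-problem summit: the doubled namespace component `ResolutionOfSingularities` is forced
set_option linter.dupNamespace false

open Literature.AlgebraicGeometry.Resolution IsLocalRing
open Summit.ResolutionOfSingularities.ResolutionOfSingularities.Theorems.SepExcModels.ModelValuationOrder
open Summit.ResolutionOfSingularities.ResolutionOfSingularities.Theorems.SepExcModels.ModelValuationResidue
open Summit.ResolutionOfSingularities.ResolutionOfSingularities.Theorems.SepExcModels.ModelValuationAbhyankar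

namespace Summit.ResolutionOfSingularities.ResolutionOfSingularities.Theorems.SepExcModels.ModelValuation

/-! ## Cardinal bookkeeping -/

/-- From `a + e = n`, `b + 1 = e` (cardinals `a, b`, naturals `e, n`): `a + b = n - 1` and
`n ≤ (n - 1) + 1`. [folklore] -/
theorem trdeg_bookkeeping {a b : Cardinal} {e n : ℕ} (hae : a + e = n) (hbe : b + 1 = e) :
    a + b = ((n - 1 : ℕ) : Cardinal) ∧ n ≤ (n - 1) + 1 := by
  have hb : b < Cardinal.aleph0 := by
    refine lt_of_le_of_lt ?_ (Cardinal.natCast_lt_aleph0 (n := e))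
    rw [← hbe]
    exact self_le_add_right b 1
  have ha : a < Cardinal.aleph0 := by
    refine lt_of_le_of_lt ?_ (Cardinal.natCast_lt_aleph0 (n := n))
    rw [← hae]
    exact self_le_add_right a e
  obtain ⟨a', rfl⟩ := Cardinal.lt_aleph0.mp ha
  obtain ⟨b', rfl⟩ := Cardinal.lt_aleph0.mp hb
  have h1 : a' + e = n := by exact_mod_cast hae
  have h2 : b' + 1 = e := by exact_mod_cast hbe
  refine ⟨?_, by omega⟩
  have h3 : a' + b' = n - 1 := by omega
  exact_mod_cast h3

/-! ## The registered stub -/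

/-- **STUB (T6, ring form — the converse) of line `birth` of crux `SepExcModels`, PROVED: a
separable regular birational local model yields an Abhyankar place dominating `R` with formally
smooth residue field extension.** Given the third disjunct of `SepExcAt` at `R = A_P`
(`B = R[s]`, `𝔮` over `𝔪_R`, `B_𝔮` regular, `(B/𝔮)[1/g]` smooth over `κ(R)`), the ORDER
VALUATION of the regular local ring `B_𝔮` (the discrete valuation ring `B_𝔮[𝔪/x]_{(x)}` of the
first quadratic transform; the trivial valuation if `𝔮 = ⊥`) dominates `R`, is a prime divisor of
`K/k` (hence Abhyankar: one value, `tr.deg − 1` independent residues), and its residue field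
`κ(B_𝔮)(t₁,…,t_{d−1})` is purely transcendental over `Frac((B/𝔮)[1/g])`, which is formally
smooth over `κ(R)`. [cite: ZariskiSamuel1960, VI §14 Thm. 31; KnafKuhlmann2005, Thm. 2.1] -/
theorem stub_sepAbhyankarPlace_of_model {k A K R : Type} [Field k]
    [CommRing A] [Algebra k A] [Algebra.FiniteType k A] [Field K] [Algebra k K] [Algebra A K]
    [IsScalarTower k A K] [IsFractionRing A K] [CommRing R] [IsLocalRing R] [Algebra A R]
    [Algebra R K] [IsScalarTower A R K] (P : Ideal A) [P.IsPrime] [IsLocalization.AtPrime R P]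
    (s : Finset K) (𝔮 : Ideal (Algebra.adjoin R (s : Set K))) [𝔮.IsPrime]
    (hle : IsLocalRing.maximalIdeal R ≤ 𝔮.comap (algebraMap R (Algebra.adjoin R (s : Set K))))
    (hreg : IsRegularLocalRing (Localization.AtPrime 𝔮))
    (g : Algebra.adjoin R (s : Set K)) (hg : g ∉ 𝔮)
    (hsm : @Algebra.Smooth (R ⧸ IsLocalRing.maximalIdeal R) _
      (Localization.Away (Ideal.Quotient.mk 𝔮 g)) _
      ((algebraMap _ (Localization.Away (Ideal.Quotient.mk 𝔮 g))).comp
        (Ideal.quotientMap 𝔮 (algebraMap R (Algebra.adjoin R (s : Set K))) hle)).toAlgebra) :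
    ∃ (O : ValuationSubring K) (φ : R →+* O) (_ : ∀ r : R, (φ r : K) = algebraMap R K r)
      (hdom : IsLocalRing.maximalIdeal R ≤ (IsLocalRing.maximalIdeal O).comap φ),
      IsAbhyankarPlace O (algebraMap k K).fieldRange ⊤ ∧
        @Algebra.FormallySmooth (R ⧸ IsLocalRing.maximalIdeal R)
          (O ⧸ IsLocalRing.maximalIdeal O) _ _
          (Ideal.quotientMap (IsLocalRing.maximalIdeal O) φ hdom).toAlgebra := by
  classical
  haveI : IsDomain A :=
    Function.Injective.isDomain (algebraMap A K) (IsFractionRing.injective A K)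
  haveI : IsFractionRing R K :=
    IsFractionRing.isFractionRing_of_isDomain_of_isLocalization P.primeCompl R K
  haveI : IsDomain R :=
    Function.Injective.isDomain (algebraMap R K) (IsFractionRing.injective R K)
  haveI := hreg
  have hkK : ∀ c : k, algebraMap k K c = algebraMap R K (algebraMap A R (algebraMap k A c)) :=
    fun c => by rw [IsScalarTower.algebraMap_apply k A K, IsScalarTower.algebraMap_apply A R K]
  have hRBK : ∀ r : R, ((algebraMap R (Algebra.adjoin R (s : Set K)) r : _) : K) =
      algebraMap R K r := fun r => rfl
  -- the `k`-structure of `S = B_𝔮` through `A`, and the dimension count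
  letI algkS : Algebra k (Localization.AtPrime 𝔮) :=
    ((algebraMap A (Localization.AtPrime 𝔮)).comp (algebraMap k A)).toAlgebra
  haveI : IsScalarTower k A (Localization.AtPrime 𝔮) := IsScalarTower.of_algebraMap_eq fun _ => rfl
  obtain ⟨n, e, hnK, hdimS, htrS⟩ :=
    exists_trdeg_residueField_add_eq (k := k) (S := Localization.AtPrime 𝔮) P s 𝔮
  by_cases hbot : 𝔮 = ⊥
  · /- the degenerate case `𝔮 = 0`: `𝔪_R = 0`, `R = K`, the trivial place -/
    have hmR : ∀ r ∈ maximalIdeal R, r = 0 := fun r hr => by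
      have h1 : algebraMap R (Algebra.adjoin R (s : Set K)) r = 0 := by
        have h2 := hle hr
        rw [Ideal.mem_comap, hbot, Ideal.mem_bot] at h2
        exact h2
      apply IsFractionRing.injective R K
      rw [← hRBK, h1, map_zero]
      rfl
    have hsurj : Function.Surjective (algebraMap R K) := fun z => by
      obtain ⟨a, b, hb, rfl⟩ := IsFractionRing.div_surjective (A := R) z
      have hb0 : b ≠ 0 := nonZeroDivisors.ne_zero hb
      have hbu : IsUnit b := by
        by_contra hbu
        exact hb0 (hmR b ((mem_maximalIdeal b).mpr hbu))
      refine ⟨a * ↑hbu.unit⁻¹, ?_⟩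
      rw [map_mul, div_eq_mul_inv]
      congr 1
      apply eq_inv_of_mul_eq_one_left
      rw [← map_mul, hbu.val_inv_mul, map_one]
    let O : ValuationSubring K := ⊤
    let φ : R →+* O := (algebraMap R K).codRestrict O fun _ => ValuationSubring.mem_top _
    have hφbij : Function.Bijective φ := by
      refine ⟨fun a b hab => IsFractionRing.injective R K (congrArg Subtype.val hab), ?_⟩
      rintro ⟨z, hz⟩
      obtain ⟨r, rfl⟩ := hsurj z
      exact ⟨r, rfl⟩
    have hdom : maximalIdeal R ≤ (maximalIdeal O).comap φ := fun r hr => by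
      rw [hmR r hr]
      exact Ideal.zero_mem _
    refine ⟨O, φ, fun r => rfl, hdom, ?_, ?_⟩
    · exact isAbhyankarPlace_top hnK
    · exact formallySmooth_quotient_of_bijective φ hφbij hdom
  · /- the main case: the order valuation of the regular local ring `S = B_𝔮` -/
    -- `S = B_𝔮 ⊆ K = Frac S`
    have hunitB : ∀ y : 𝔮.primeCompl, IsUnit (algebraMap (Algebra.adjoin R (s : Set K)) K y) :=
      fun y => isUnit_iff_ne_zero.mpr fun h0 => y.2 (by
        rw [show (y : Algebra.adjoin R (s : Set K)) = 0 from Subtype.ext h0]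
        exact 𝔮.zero_mem)
    letI algSK : Algebra (Localization.AtPrime 𝔮) K :=
      (IsLocalization.lift (M := 𝔮.primeCompl) (S := Localization.AtPrime 𝔮) hunitB).toAlgebra
    have hBSK : ∀ b : Algebra.adjoin R (s : Set K), algebraMap (Localization.AtPrime 𝔮) K
        (algebraMap (Algebra.adjoin R (s : Set K)) (Localization.AtPrime 𝔮) b) = b :=
      fun b => IsLocalization.lift_eq hunitB b
    haveI : IsScalarTower (Algebra.adjoin R (s : Set K)) (Localization.AtPrime 𝔮) K :=
      IsScalarTower.of_algebraMap_eq fun b => (hBSK b).symm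
    haveI : FaithfulSMul (Algebra.adjoin R (s : Set K)) K :=
      (faithfulSMul_iff_algebraMap_injective _ K).mpr Subtype.val_injective
    haveI : IsFractionRing (Algebra.adjoin R (s : Set K)) K := by
      refine IsFractionRing.of_field (Algebra.adjoin R (s : Set K)) K fun z => ?_
      obtain ⟨a, b, -, rfl⟩ := IsFractionRing.div_surjective (A := R) z
      exact ⟨algebraMap R _ a, algebraMap R _ b, rfl⟩
    haveI : IsFractionRing (Localization.AtPrime 𝔮) K :=
      IsFractionRing.isFractionRing_of_isDomain_of_isLocalization 𝔮.primeCompl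
        (Localization.AtPrime 𝔮) K
    -- `𝔪_S ≠ 0`, with a non-zero element `x₀`
    obtain ⟨b₀, hb₀𝔮, hb₀0⟩ := Submodule.exists_mem_ne_zero_of_ne_bot hbot
    have hb₀S : algebraMap (Algebra.adjoin R (s : Set K)) (Localization.AtPrime 𝔮) b₀ ∈
        maximalIdeal (Localization.AtPrime 𝔮) :=
      (IsLocalization.AtPrime.to_map_mem_maximal_iff (Localization.AtPrime 𝔮) 𝔮 b₀).mpr hb₀𝔮
    have hb₀S0 : algebraMap (Algebra.adjoin R (s : Set K)) (Localization.AtPrime 𝔮) b₀ ≠ 0 :=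
      fun h0 => hb₀0 (IsLocalization.injective (Localization.AtPrime 𝔮)
        𝔮.primeCompl_le_nonZeroDivisors (h0.trans (map_zero _).symm))
    have hmS : maximalIdeal (Localization.AtPrime 𝔮) ≠ ⊥ := fun h =>
      hb₀S0 (by rw [h, Ideal.mem_bot] at hb₀S; exact hb₀S)
    -- the order valuation of `S`
    obtain ⟨O, ψ, hψK, hdomS, hsmO, htrO⟩ := exists_orderValuation (Localization.AtPrime 𝔮) K hmS
    -- `R → B → S → O`
    let ρ : R →+* Localization.AtPrime 𝔮 :=
      (algebraMap (Algebra.adjoin R (s : Set K)) (Localization.AtPrime 𝔮)).comp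
        (algebraMap R (Algebra.adjoin R (s : Set K)))
    have hRS : maximalIdeal R ≤ (maximalIdeal (Localization.AtPrime 𝔮)).comap ρ := fun r hr => by
      rw [Ideal.mem_comap]
      exact (IsLocalization.AtPrime.to_map_mem_maximal_iff (Localization.AtPrime 𝔮) 𝔮 _).mpr
        (hle hr)
    let φ : R →+* O := ψ.comp ρ
    have hφ : ∀ r : R, (φ r : K) = algebraMap R K r := fun r => by
      show ((ψ (algebraMap (Algebra.adjoin R (s : Set K)) (Localization.AtPrime 𝔮)
        (algebraMap R (Algebra.adjoin R (s : Set K)) r)) : O) : K) = algebraMap R K r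
      rw [hψK, hBSK, hRBK]
    have hdom : maximalIdeal R ≤ (maximalIdeal O).comap φ := fun r hr => by
      rw [Ideal.mem_comap]
      exact hdomS (hRS hr)
    refine ⟨O, φ, hφ, hdom, ?_, ?_⟩
    · /- `O` is a prime divisor, hence an Abhyankar place -/
      have hkO : ∀ c : k, algebraMap k K c ∈ O := fun c => by
        rw [hkK c, ← hφ]
        exact (φ _).2
      -- the value `< 1`
      have hv : O.valuation (algebraMap (Localization.AtPrime 𝔮) K
          (algebraMap (Algebra.adjoin R (s : Set K)) (Localization.AtPrime 𝔮) b₀)) < 1 := by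
        rw [← hψK]
        exact (ValuationSubring.valuation_lt_one_iff O _).mp (hdomS hb₀S)
      have hx₀ : algebraMap (Localization.AtPrime 𝔮) K
          (algebraMap (Algebra.adjoin R (s : Set K)) (Localization.AtPrime 𝔮) b₀) ≠ 0 :=
        fun h0 => hb₀S0 (IsFractionRing.injective (Localization.AtPrime 𝔮) K
          (h0.trans (map_zero _).symm))
      -- the `k`-structure of `O` (`k ⊆ O`), compatible with `K`
      letI algkO : Algebra k O := algebraOfMem k O hkO
      haveI : IsScalarTower k O K := isScalarTower_algebraOfMem k O hkO
      -- the tower `k → κ(S) → κ(O)`: `ψ(c) = c` in `O` for `c ∈ k`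
      have hψk : ∀ c : k, ψ (algebraMap k (Localization.AtPrime 𝔮) c) = algebraMap k O c := by
        intro c
        apply Subtype.ext
        rw [hψK]
        show algebraMap (Localization.AtPrime 𝔮) K (algebraMap A (Localization.AtPrime 𝔮)
          (algebraMap k A c)) = algebraMap k K c
        rw [IsScalarTower.algebraMap_apply A (Algebra.adjoin R (s : Set K)) (Localization.AtPrime 𝔮),
          hBSK, IsScalarTower.algebraMap_apply A R (Algebra.adjoin R (s : Set K)), hRBK, hkK]
      letI algSO : Algebra (ResidueField (Localization.AtPrime 𝔮)) (ResidueField O) :=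
        (Ideal.quotientMap (maximalIdeal O) ψ hdomS).toAlgebra
      haveI : IsScalarTower k (ResidueField (Localization.AtPrime 𝔮)) (ResidueField O) := by
        refine IsScalarTower.of_algebraMap_eq fun c => ?_
        rw [IsScalarTower.algebraMap_apply k O (ResidueField O), ResidueField.algebraMap_eq,
          ← hψk, IsScalarTower.algebraMap_apply k (Localization.AtPrime 𝔮)
            (ResidueField (Localization.AtPrime 𝔮)), ResidueField.algebraMap_eq]
        rfl
      have htrO' : Algebra.trdeg (ResidueField (Localization.AtPrime 𝔮)) (ResidueField O) + 1 =
          (maximalIdeal (Localization.AtPrime 𝔮)).spanFinrank := htrO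
      have hspan : (maximalIdeal (Localization.AtPrime 𝔮)).spanFinrank = e := by
        have h := hreg.spanFinrank_maximalIdeal
        rw [hdimS] at h
        exact_mod_cast h
      rw [hspan] at htrO'
      haveI : FaithfulSMul (ResidueField (Localization.AtPrime 𝔮)) (ResidueField O) :=
        (faithfulSMul_iff_algebraMap_injective _ _).mpr
          (algebraMap (ResidueField (Localization.AtPrime 𝔮)) (ResidueField O)).injective
      haveI : FaithfulSMul k (ResidueField (Localization.AtPrime 𝔮)) :=
        (faithfulSMul_iff_algebraMap_injective _ _).mpr
          (algebraMap k (ResidueField (Localization.AtPrime 𝔮))).injective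
      have htower : Algebra.trdeg k (ResidueField O) =
          Algebra.trdeg k (ResidueField (Localization.AtPrime 𝔮)) +
            Algebra.trdeg (ResidueField (Localization.AtPrime 𝔮)) (ResidueField O) :=
        (trdeg_add_eq k (ResidueField (Localization.AtPrime 𝔮)) (A := ResidueField O)).symm
      obtain ⟨hsum, hn⟩ := trdeg_bookkeeping htrS htrO'
      have hres : residueTrdeg k O hkO = (n - 1 : ℕ) := by
        rw [residueTrdeg_eq O hkO, htower, hsum]
      obtain ⟨y, hy⟩ := exists_algebraicIndependent_residue_of_residueTrdeg_eq O hkO (n - 1) hres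
      have htr : Algebra.trdeg k K ≤ ((n - 1) + 1 : ℕ) := by
        rw [hnK]
        exact_mod_cast hn
      exact isAbhyankarPlace_of_valuation_lt_one O hv hx₀ y hy htr
    · /- `κ(O)` is formally smooth over `κ(R)`: `κ(R) → κ(S) → κ(O)` -/
      letI algRS : Algebra (R ⧸ maximalIdeal R) (ResidueField (Localization.AtPrime 𝔮)) :=
        (Ideal.quotientMap (maximalIdeal (Localization.AtPrime 𝔮)) ρ hRS).toAlgebra
      haveI hsmRS : Algebra.FormallySmooth (R ⧸ maximalIdeal R)
          (ResidueField (Localization.AtPrime 𝔮)) :=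
        formallySmooth_residueField_of_model 𝔮 hle g hg hsm hRS
      letI algSO : Algebra (ResidueField (Localization.AtPrime 𝔮)) (ResidueField O) :=
        (Ideal.quotientMap (maximalIdeal O) ψ hdomS).toAlgebra
      haveI hsmSO : Algebra.FormallySmooth (ResidueField (Localization.AtPrime 𝔮))
          (ResidueField O) := hsmO
      letI algRO : Algebra (R ⧸ maximalIdeal R) (ResidueField O) :=
        (Ideal.quotientMap (maximalIdeal O) φ hdom).toAlgebra
      haveI : IsScalarTower (R ⧸ maximalIdeal R) (ResidueField (Localization.AtPrime 𝔮))
          (ResidueField O) :=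
        IsScalarTower.of_algebraMap_eq fun x => by
          obtain ⟨r, rfl⟩ := Ideal.Quotient.mk_surjective x
          rfl
      exact Algebra.FormallySmooth.comp (R ⧸ maximalIdeal R)
        (ResidueField (Localization.AtPrime 𝔮)) (ResidueField O)

end Summit.ResolutionOfSingularities.ResolutionOfSingularities.Theorems.SepExcModels.ModelValuation

end
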